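import Summits.ResolutionOfSingularities.ResolutionOfSingularities.Theorems.FrobeniusLadderFRationalResolutionFRationalLocalizes
import Summits.ResolutionOfSingularities.ResolutionOfSingularities.Theorems.FrobeniusLadderFRationalResolutionStalkPresentationRegular
import Summits.ResolutionOfSingularities.ResolutionOfSingularities.Theorems.FrobeniusLadderFRationalResolutionStubClauseOfRingEquiv
import Summits.ResolutionOfSingularities.ResolutionOfSingularities.Theorems.FrobeniusLadderFRationalResolutionSpreadOutFinite
import Summits.ResolutionOfSingularities.ResolutionOfSingularities.Theorems.FrobeniusLadderFRationalResolutionOneSopScheme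
import Literature.AlgebraicGeometry.Resolution.StalkSpecializesLocalization
import Literature.AlgebraicGeometry.Resolution.PointBlowupHsFunMono
import Mathlib.AlgebraicGeometry.Morphisms.FiniteType
import Mathlib.AlgebraicGeometry.Noetherian
import HarnessLib

/-!
# The crux's F-rational hypothesis is a closed-point condition

Support file for crux stmt-ResolutionOfSingularities-15317 (`FrobeniusLadder.FRationalResolution`),
line `Sketch`, continuation seat c3, cycle 6 (theme LOC, scheme level). For a scheme `X` locally
of finite type over a field `k` of characteristic `p`:

* `forall_atPrime_of_ringEquiv` — bookkeeping: a property of all localizations at primes of a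
  ring transfers along a ring isomorphism of the base;
* `fRationalClause_of_specializes` — if `x ⤳ y` and the stalk at `y` is a domain all of whose
  full parameter ideals are tightly closed (the crux's inline clause), then so is the stalk at
  `x`: `𝒪_{X,y} ≅ S/Q` with `S` regular local (`exists_stalk_ringEquiv_regularLocal_quotient`),
  `𝒪_{X,x}` is a localization of `𝒪_{X,y}` at a prime (Stacks 01J7,
  `isLocalizationAtPrime_stalkSpecializes`), and F-rationality localizes for `S/Q`
  (`fRationalClause_atPrime`, HH94 Thm. 4.2 (f), proved in the tree);
* `fRationalClause_of_closedPoints` — hence the clause at the CLOSED points of `X` gives it at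
  every point (`X` is Jacobson);
* `fRationalClause_of_singular_closedPoints` — and regular stalks satisfy the clause for free, so it
  suffices to check the CLOSED SINGULAR points;
* `fRationalHypothesis_of_one_sop_at_singular_closedPoints` — combined with HH94 Prop. 6.27 (a) at
  stalks (`fRationalClause_of_one_sop_stalk`): ONE tightly closed system-of-parameters ideal at
  each closed singular point certifies the crux's hypothesis on all of `X`.

[cite: HochsterHuneke1994, Thm. 4.2 (f)]
-/

-- single-problem summit: the doubled namespace component is forced
set_option linter.dupNamespace false

noncomputable section

namespace Summit.ResolutionOfSingularities.ResolutionOfSingularities.Theorems.FRationalResolution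

open CategoryTheory AlgebraicGeometry TopologicalSpace IsLocalRing
open Literature.AlgebraicGeometry.Resolution

/-- **Base change of "every localization at a prime satisfies `C`" along a ring isomorphism.**
If `e : R ≃+* R'` and every localization of `R'` at a prime satisfies a property `C` of rings,
then so does every localization `A` of `R` at a prime `P`: `A` is the localization of `R'` at
`e(P)` for the induced algebra structure. [folklore] -/
theorem forall_atPrime_of_ringEquiv (C : ∀ (A : Type), [CommRing A] → Prop)
    {R R' : Type} [CommRing R] [CommRing R'] (e : R ≃+* R')
    (hR' : ∀ (P' : Ideal R') [P'.IsPrime] (A : Type) [CommRing A] [Algebra R' A]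
      [IsLocalization.AtPrime A P'], C A)
    (P : Ideal R) [P.IsPrime] (A : Type) [CommRing A] [Algebra R A] [IsLocalization.AtPrime A P] :
    C A := by
  -- the prime `P' = e(P)` of `R'`
  set P' : Ideal R' := P.map (e : R →+* R') with hP'
  have hP'c : P' = P.comap (e.symm : R' →+* R) := by
    rw [hP']
    exact Ideal.map_comap_of_equiv e
  haveI : P'.IsPrime := by
    rw [hP'c]
    exact Ideal.comap_isPrime (e.symm : R' →+* R) P
  -- the submonoids match
  have hM : P.primeCompl.map (e : R →* R') = P'.primeCompl := by
    ext z
    simp only [Submonoid.mem_map, Ideal.mem_primeCompl_iff, hP'c, Ideal.mem_comap, RingHom.coe_coe]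
    constructor
    · rintro ⟨y, hy, rfl⟩
      simpa using hy
    · intro hz
      exact ⟨e.symm z, hz, by simp⟩
  -- `A` as an `R'`-algebra is the localization at `P'`
  letI : Algebra R' A := ((algebraMap R A).comp e.symm.toRingHom).toAlgebra
  haveI : IsLocalization.AtPrime A P' := by
    have h := IsLocalization.isLocalization_of_base_ringEquiv P.primeCompl A e
    rw [show (P.primeCompl.map e : Submonoid R') = P'.primeCompl from ?_] at h
    · exact h
    · rw [← hM]
      rfl
  exact hR' P' A

/-- **The F-rational clause passes to generizations.** Let `f : X → Spec k` be locally of finite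
type, `char k = p`, and `x ⤳ y` in `X`. If the stalk at `y` is a domain all of whose ideals
generated by a full system of parameters are tightly closed (inline clause of crux
`FRationalResolution`), then the same holds for the stalk at `x`.
[cite: HochsterHuneke1994, Thm. 4.2 (f)] -/
theorem fRationalClause_of_specializes (p : ℕ) (hp : p.Prime) (k : Type) [Field k] [CharP k p]
    (X : Scheme.{0}) (f : X ⟶ Spec (.of k)) [LocallyOfFiniteType f] {x y : X} (hxy : x ⤳ y)
    (hy : IsDomain (X.presheaf.stalk y) ∧ ∀ d : ℕ, ringKrullDim (X.presheaf.stalk y) = d →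
      ∀ s : Fin d → X.presheaf.stalk y, (Ideal.span (Set.range s)).radical.IsMaximal →
      ∀ z c : X.presheaf.stalk y, c ≠ 0 →
      (∀ e : ℕ, c * z ^ p ^ e ∈ Ideal.span ((fun w : X.presheaf.stalk y => w ^ p ^ e) ''
        (Ideal.span (Set.range s) : Set (X.presheaf.stalk y)))) → z ∈ Ideal.span (Set.range s)) :
    IsDomain (X.presheaf.stalk x) ∧ ∀ d : ℕ, ringKrullDim (X.presheaf.stalk x) = d →
      ∀ s : Fin d → X.presheaf.stalk x, (Ideal.span (Set.range s)).radical.IsMaximal →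
      ∀ z c : X.presheaf.stalk x, c ≠ 0 →
      (∀ e : ℕ, c * z ^ p ^ e ∈ Ideal.span ((fun w : X.presheaf.stalk x => w ^ p ^ e) ''
        (Ideal.span (Set.range s) : Set (X.presheaf.stalk x)))) → z ∈ Ideal.span (Set.range s) := by
  haveI : Fact p.Prime := ⟨hp⟩
  haveI := hy.1
  -- `𝒪_{X,y} ≅ S/Q`
  obtain ⟨S, _, _, _, Q, hQ, ⟨e⟩⟩ := exists_stalk_ringEquiv_regularLocal_quotient hp k X f y
  haveI := hQ
  have hSQ := (ClauseInvariance.stub_clause_of_ringEquiv p e hy).2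
  -- `𝒪_{X,x}` is a localization of `𝒪_{X,y}` at a prime
  letI := (X.presheaf.stalkSpecializes hxy).hom.toAlgebra
  haveI hloc : IsLocalization.AtPrime (X.presheaf.stalk x)
      ((maximalIdeal (X.presheaf.stalk x)).comap (X.presheaf.stalkSpecializes hxy).hom) :=
    isLocalizationAtPrime_stalkSpecializes hxy
  exact forall_atPrime_of_ringEquiv
    (fun A _ => IsDomain A ∧ ∀ d : ℕ, ringKrullDim A = d → ∀ s : Fin d → A,
      (Ideal.span (Set.range s)).radical.IsMaximal → ∀ z c : A, c ≠ 0 →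
      (∀ e : ℕ, c * z ^ p ^ e ∈ Ideal.span ((fun w : A => w ^ p ^ e) ''
        (Ideal.span (Set.range s) : Set A))) → z ∈ Ideal.span (Set.range s))
    e (fun P' _ A _ _ _ => fRationalClause_atPrime p S Q hSQ P' A)
    ((maximalIdeal (X.presheaf.stalk x)).comap (X.presheaf.stalkSpecializes hxy).hom)
    (X.presheaf.stalk x)

/-- **The crux's F-rational hypothesis is a closed-point condition.** For `f : X → Spec k` locally
of finite type (`char k = p`): if at every CLOSED point the stalk is a domain all of whose full
parameter ideals are tightly closed, then the same holds at every point of `X` (Jacobson: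
every point specialises to a closed point). [cite: HochsterHuneke1994, Thm. 4.2 (f)] -/
theorem fRationalClause_of_closedPoints (p : ℕ) (hp : p.Prime) (k : Type) [Field k] [CharP k p]
    (X : Scheme.{0}) (f : X ⟶ Spec (.of k)) [LocallyOfFiniteType f]
    (h : ∀ y : X, IsClosed ({y} : Set X) →
      IsDomain (X.presheaf.stalk y) ∧ ∀ d : ℕ, ringKrullDim (X.presheaf.stalk y) = d →
      ∀ s : Fin d → X.presheaf.stalk y, (Ideal.span (Set.range s)).radical.IsMaximal →
      ∀ z c : X.presheaf.stalk y, c ≠ 0 →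
      (∀ e : ℕ, c * z ^ p ^ e ∈ Ideal.span ((fun w : X.presheaf.stalk y => w ^ p ^ e) ''
        (Ideal.span (Set.range s) : Set (X.presheaf.stalk y)))) → z ∈ Ideal.span (Set.range s)) :
    ∀ x : X, IsDomain (X.presheaf.stalk x) ∧ ∀ d : ℕ, ringKrullDim (X.presheaf.stalk x) = d →
      ∀ s : Fin d → X.presheaf.stalk x, (Ideal.span (Set.range s)).radical.IsMaximal →
      ∀ z c : X.presheaf.stalk x, c ≠ 0 →
      (∀ e : ℕ, c * z ^ p ^ e ∈ Ideal.span ((fun w : X.presheaf.stalk x => w ^ p ^ e) ''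
        (Ideal.span (Set.range s) : Set (X.presheaf.stalk x)))) → z ∈ Ideal.span (Set.range s) := by
  haveI : JacobsonSpace X := LocallyOfFiniteType.jacobsonSpace f
  intro x
  obtain ⟨y, hyc, hxy⟩ := exists_isClosed_and_specializes_of_jacobsonSpace x
  exact fRationalClause_of_specializes p hp k X f hxy (h y hyc)

/-- **Certification at the closed singular points suffices.** For `f : X → Spec k` locally of
finite type (`char k = p`): if at every closed point OUTSIDE the regular locus the stalk is a
domain all of whose full parameter ideals are tightly closed, then the F-rational clause of crux
`FRationalResolution` holds at every point of `X` (regular stalks have every ideal tightly closed,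
`weaklyFRegularClause_stalk_of_mem_regularLocus`; then `fRationalClause_of_closedPoints`).
[cite: HochsterHuneke1994, Thm. 4.2 (f); HunekeSwanson2006, Thm. 13.1.2 (6)] -/
theorem fRationalClause_of_singular_closedPoints (p : ℕ) (hp : p.Prime) (k : Type) [Field k]
    [CharP k p] (X : Scheme.{0}) (f : X ⟶ Spec (.of k)) [LocallyOfFiniteType f]
    (h : ∀ y : X, IsClosed ({y} : Set X) → y ∉ Scheme.regularLocus X →
      IsDomain (X.presheaf.stalk y) ∧ ∀ d : ℕ, ringKrullDim (X.presheaf.stalk y) = d →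
      ∀ s : Fin d → X.presheaf.stalk y, (Ideal.span (Set.range s)).radical.IsMaximal →
      ∀ z c : X.presheaf.stalk y, c ≠ 0 →
      (∀ e : ℕ, c * z ^ p ^ e ∈ Ideal.span ((fun w : X.presheaf.stalk y => w ^ p ^ e) ''
        (Ideal.span (Set.range s) : Set (X.presheaf.stalk y)))) → z ∈ Ideal.span (Set.range s)) :
    ∀ x : X, IsDomain (X.presheaf.stalk x) ∧ ∀ d : ℕ, ringKrullDim (X.presheaf.stalk x) = d →
      ∀ s : Fin d → X.presheaf.stalk x, (Ideal.span (Set.range s)).radical.IsMaximal →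
      ∀ z c : X.presheaf.stalk x, c ≠ 0 →
      (∀ e : ℕ, c * z ^ p ^ e ∈ Ideal.span ((fun w : X.presheaf.stalk x => w ^ p ^ e) ''
        (Ideal.span (Set.range s) : Set (X.presheaf.stalk x)))) → z ∈ Ideal.span (Set.range s) := by
  refine fRationalClause_of_closedPoints p hp k X f fun y hyc => ?_
  by_cases hy : y ∈ Scheme.regularLocus X
  · haveI : IsRegularLocalRing (X.presheaf.stalk y) := hy
    exact ⟨isDomain_of_isRegularLocalRing _, fun d _ s _ z c hc hz =>
      weaklyFRegularClause_stalk_of_mem_regularLocus p hp k X f hy (Ideal.span (Set.range s))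
        z c hc hz⟩
  · exact h y hyc hy

/-- **THE CERTIFICATION THEOREM.** For `f : X → Spec k` locally of finite type over a field of
characteristic `p`: if at every CLOSED SINGULAR point `y` the stalk is a domain and ONE ideal
generated by `dim 𝒪_{X,y}` elements with maximal radical is tightly closed (inline test), then the
F-rational hypothesis of crux `FRationalResolution` holds at EVERY point of `X`
(HH94 Prop. 6.27 (a) at the stalk, then Thm. 4.2 (f) to pass to all points).
[cite: HochsterHuneke1994, Prop. 6.27 (a), Thm. 4.2 (f)] -/
theorem fRationalHypothesis_of_one_sop_at_singular_closedPoints (p : ℕ) (hp : p.Prime) (k : Type)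
    [Field k] [CharP k p] (X : Scheme.{0}) (f : X ⟶ Spec (.of k)) [LocallyOfFiniteType f]
    (h : ∀ y : X, IsClosed ({y} : Set X) → y ∉ Scheme.regularLocus X →
      IsDomain (X.presheaf.stalk y) ∧ ∃ (d₀ : ℕ) (s₀ : Fin d₀ → X.presheaf.stalk y),
      ringKrullDim (X.presheaf.stalk y) = d₀ ∧ (Ideal.span (Set.range s₀)).radical.IsMaximal ∧
      ∀ z c : X.presheaf.stalk y, c ≠ 0 → (∀ e : ℕ, c * z ^ p ^ e ∈
        Ideal.span ((fun w : X.presheaf.stalk y => w ^ p ^ e) ''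
          (Ideal.span (Set.range s₀) : Set (X.presheaf.stalk y)))) →
        z ∈ Ideal.span (Set.range s₀)) :
    ∀ x : X, IsDomain (X.presheaf.stalk x) ∧ ∀ d : ℕ, ringKrullDim (X.presheaf.stalk x) = d →
      ∀ s : Fin d → X.presheaf.stalk x, (Ideal.span (Set.range s)).radical.IsMaximal →
      ∀ z c : X.presheaf.stalk x, c ≠ 0 →
      (∀ e : ℕ, c * z ^ p ^ e ∈ Ideal.span ((fun w : X.presheaf.stalk x => w ^ p ^ e) ''
        (Ideal.span (Set.range s) : Set (X.presheaf.stalk x)))) → z ∈ Ideal.span (Set.range s) := by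
  refine fRationalClause_of_singular_closedPoints p hp k X f fun y hyc hys => ?_
  obtain ⟨hdom, d₀, s₀, hd₀, hs₀, htc₀⟩ := h y hyc hys
  haveI := hdom
  exact fRationalClause_of_one_sop_stalk p hp k X f y hd₀ s₀ hs₀ htc₀

end Summit.ResolutionOfSingularities.ResolutionOfSingularities.Theorems.FRationalResolution

end
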